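import Literature.AlgebraicGeometry.AbelianSchemes.RosatiAtPointOfWeilDivisorPullback
import Literature.AlgebraicGeometry.AbelianSchemes.AbelianSchemeOverFibreIdentity
import Literature.AlgebraicGeometry.Motives.AbelianVarietyHomTorsionDetermined
import HarnessLib

/-!
# RIGIDITY OF `Λ(𝒪(·))` ON TORSION: two homomorphisms `L, L′ : A → Â` that are `Λ(𝒪(Θ))`, `Λ(𝒪(Θ′))` at a geometric point with
# `D^Θ_Q ∼ D^{Θ′}_Q` on all TORSION points `Q` have equal fibres ([MumfordAV1970] §8, §19 Thm. 3, §20; [MumfordFogartyKirwan1994] Def. 6.2–6.3)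

Topic `AlgebraicGeometry/AbelianSchemes`, namespace `Literature.AlgebraicGeometry.AbelianSchemes.AbelianSchemeOver`.  THEOREMS ONLY (no definition, no named fact,
no `instance`, no notation, no `sorry`).  Cell `hodgecm-mathlib` (D-0151), F0∕P6 «MOD», «GO 500» half A line L5 (EHECKE closer `Lines/F0_P6a_StubEHECKE.lean` of
LA5-plan (g3), assemblers (O-R1) LA5-p01 (g3) ∕ (O-R2) A-p06 (g35)): **organ (ρ-SIM) §1 — the SCHEME HALF of the similitude law `h ≫ λ₂ ≫ h^∨ = λ₁ ≫ [ν]` of a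
homomorphism read on symplectic torsion towers**: the binder `hsim` of ★ `exists_roof_of_idealHomFamily(_of_isAlgClosed)` (p849932∕p849956) is an EQUALITY of two
homomorphisms `A₁ → Â₁` both of which are `Λ(𝒪(·))` at the point (★ `IsLambdaOfAt.pullback_isogeny`, ★ `IsLambdaOfAt.pow_nsmul`); this file reduces such an equality to
a Weil-divisor congruence ON TORSION POINTS ONLY (which the tower file ★ `PolarizationLawOfSymplecticTowerReading` reads off the level Weil pairings).  A-p06 (g35); `--supports stmt-HodgeConjecture-24832`,
count-neutral.  HONEST LABEL: HC_CM is proved only modulo the 7 printed citations (2 remaining: hLiu418 = stmt-HodgeConjecture-24832, h413 = stmt-HodgeConjecture-24833)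
until rung 0 closes; this file is generic and discharges none of them.

## Mathematics

`A∕S` an abelian scheme with dual pair `(Â, 𝒫)`, `s : Spec Ω → S` a point, `L, L′ : A → Â` homomorphisms over `S` with `L = Λ(𝒪(Θ))` and `L′ = Λ(𝒪(Θ′))` at `s`
(★ `IsLambdaOfAt`: the 𝒫-slice at `L̄(Q)` is `t_Q^*𝒪(Θ) ⊗ 𝒪(Θ)⁻¹ = 𝒪(D^Θ_Q)`, `D^Θ_Q = t_Q^*Θ − Θ`, [MumfordFogartyKirwan1994] Def. 6.2).  (§1) If `D^Θ_Q ∼ D^{Θ′}_Q` then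
the two slices at `L̄(Q)` and `L̄′(Q)` are isomorphic rank-one modules ([Hartshorne1977] III Ex. 4.5 ∕ ★ `nonempty_iso_iff_detClass_eq`, ★
`detClass_translateTensorDual_eq_cechClass_weilDiv`, [GortzWedhorn2020] Prop. 11.21 ∕ ★ `cechClass_eq_iff_linEquiv`), so `L̄(Q) = L̄′(Q)` as points of `Â` («`b ↦ [𝒫|_{A×{b}}]` is
injective», [MilneAV2008] I §8, ★ `DualPair.eq_of_nonempty_iso`), hence `L_s(Q) = L′_s(Q)` in `Â_s(Ω)`.  (§2) Over `Ω` algebraically closed of characteristic `0`, if this holds for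
every TORSION `Q` then `L_s = L′_s` ([MumfordAV1970] §19 Thm. 3 ∕ [Milne1986AbelianVarieties] Lemma 12.6: torsion points separate homomorphisms, ★
`hom_eq_of_forall_torsionPoints_map`); and over `S = Spec Ω` itself (`s = 𝟙`) this is `L = L′` (★ `overPullbackIdIso`: the identity fibre is `A`).

## Contents
* §1 `valueAt_eq_valueAt_of_weilDiv_linEquiv`, `map_fibreHom_eq_of_valueAt_eq`, `map_fibreHom_eq_of_weilDiv_linEquiv`;
* §2 **`fibreHom_eq_of_isLambdaOfAt_of_forall_torsion_weilDiv_linEquiv`**, **`eq_of_isLambdaOfAt_of_forall_torsion_weilDiv_linEquiv`** (`S = Spec Ω`).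

## References
* [MumfordAV1970] D. Mumford, *Abelian Varieties* (1970), §8 (pp. 74–75), §19 Thm. 3 (p. 176), §20 property (3) (p. 186), §23 (p. 208).
* [MumfordFogartyKirwan1994] D. Mumford, J. Fogarty, F. Kirwan, *Geometric Invariant Theory*, 3rd ed. (1994), Ch. 6 §2 Def. 6.2–6.3 (p. 120).
* [MilneAV2008] J. S. Milne, *Abelian Varieties* (2008), I §8 pp. 36–37.  [Milne1986AbelianVarieties] §12 Lemma 12.6.
* [GortzWedhorn2020] U. Görtz, T. Wedhorn, *Algebraic Geometry I*, Prop. 11.21 (p. 374).  [Hartshorne1977] III Ex. 4.5.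
* Tree: ★ `RosatiAtPointOfWeilDivisorPullback` (the one-variety Rosati twin of §1), ★ `AbelianSchemeOverFibreIdentity`, ★ `Motives/AbelianVarietyHomTorsionDetermined`.
-/

set_option autoImplicit false

noncomputable section

universe u

open CategoryTheory CategoryTheory.Limits AlgebraicGeometry MonoidalCategory
open scoped MonObj

namespace Literature.AlgebraicGeometry.AbelianSchemes

namespace AbelianSchemeOver

open Literature.AlgebraicGeometry.Motives Literature.AlgebraicGeometry.AbelianVarieties Literature.AlgebraicGeometry.Modules

variable {S : Scheme.{u}} {A : AbelianSchemeOver S} (D : A.DualPair) (L L' : A.X ⟶ D.hat.X)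
  {Ω : Type u} [Field Ω] (s : Spec (.of Ω) ⟶ S)

/-! ### §1 Equal values at one point from a Weil-divisor congruence -/

/-- **`L̄(Q) = L̄′(Q)` as points of `Â`** when `L = Λ(𝒪(Θ))`, `L′ = Λ(𝒪(Θ′))` at `s` and `D^Θ_Q ∼ D^{Θ′}_Q`: both 𝒫-slices are `𝒪(D^Θ_Q) ≅ 𝒪(D^{Θ′}_Q)`, and a point of
`Â` is determined by its slice. [cite: MumfordFogartyKirwan1994, Ch. 6 §2 Definition 6.2–6.3 (p. 120)] [cite: MilneAV2008, I §8 pp. 36–37] [cite: GortzWedhorn2020, Prop. 11.21 (p. 374)] -/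
theorem valueAt_eq_valueAt_of_weilDiv_linEquiv {Θ Θ' : CartierDivisor (A.fibre s).toAbelianVariety.X.left}
    (hΘ : A.IsLambdaOfAt s D L Θ) (hΘ' : A.IsLambdaOfAt s D L' Θ') (Q : (A.fibre s).toAbelianVariety.Points Ω)
    (h : ((A.fibre s).toAbelianVariety.weilDiv Θ Q).LinEquiv ((A.fibre s).toAbelianVariety.weilDiv Θ' Q)) :
    A.valueAt s D L Q = A.valueAt s D L' Q := by
  obtain ⟨i⟩ := AbelianSchemeOver.IsLambdaOfAt.nonempty_iso A s D L hΘ Q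
  obtain ⟨i'⟩ := AbelianSchemeOver.IsLambdaOfAt.nonempty_iso A s D L' hΘ' Q
  have hQ := hasRank_translateTensorDual (A := A) s Θ Q
  have hQ' := hasRank_translateTensorDual (A := A) s Θ' Q
  have hQf : IsFiniteLocallyFree (tensorObj
      ((Scheme.Modules.pullback ((A.fibre s).toAbelianVariety.translation Q).left).obj (A.lineBundleOfDivisor s Θ))
      (Modules.dual (A.lineBundleOfDivisor s Θ))) := HasRank.isFiniteLocallyFree' hQ
  have hQf' : IsFiniteLocallyFree (tensorObj
      ((Scheme.Modules.pullback ((A.fibre s).toAbelianVariety.translation Q).left).obj (A.lineBundleOfDivisor s Θ'))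
      (Modules.dual (A.lineBundleOfDivisor s Θ'))) := HasRank.isFiniteLocallyFree' hQ'
  have e : Nonempty (tensorObj
      ((Scheme.Modules.pullback ((A.fibre s).toAbelianVariety.translation Q).left).obj (A.lineBundleOfDivisor s Θ))
      (Modules.dual (A.lineBundleOfDivisor s Θ)) ≅
    tensorObj
      ((Scheme.Modules.pullback ((A.fibre s).toAbelianVariety.translation Q).left).obj (A.lineBundleOfDivisor s Θ'))
      (Modules.dual (A.lineBundleOfDivisor s Θ'))) := by
    rw [nonempty_iso_iff_detClass_eq hQ hQ' hQf hQf', detClass_translateTensorDual_eq_cechClass_weilDiv _ Θ Q hQf,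
      detClass_translateTensorDual_eq_cechClass_weilDiv _ Θ' Q hQf', CartierDivisor.cechClass_eq_iff_linEquiv]
    exact h
  obtain ⟨e⟩ := e
  have h₁ : Nonempty (D.pullbackP s (A.valueAt s D L Q) (A.valueAt_comp_hom s D L Q) ≅
      (D.sliceBundle (A.valueAt s D L' Q) s (A.valueAt_comp_hom s D L' Q)).L) := ⟨i ≪≫ e ≪≫ i'.symm⟩
  have h₂ : Nonempty (D.pullbackP s (A.valueAt s D L' Q) (A.valueAt_comp_hom s D L' Q) ≅
      (D.sliceBundle (A.valueAt s D L' Q) s (A.valueAt_comp_hom s D L' Q)).L) := ⟨Iso.refl _⟩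
  exact D.eq_of_nonempty_iso s (D.sliceBundle (A.valueAt s D L' Q) s (A.valueAt_comp_hom s D L' Q))
    (D.sliceBundle_fibrewisePicZero _ s _) _ _ (A.valueAt_comp_hom s D L Q) (A.valueAt_comp_hom s D L' Q) h₁ h₂

/-- Two base-changed homomorphisms `L_s, L′_s : A_s → Â_s` with `L̄(Q) = L̄′(Q)` agree at the `Ω`-point `Q` (a point of `Â_s = Â ×_S Spec Ω` is its point of `Â`
plus the structure map). [cite: GortzWedhorn2020, Section (4.7) (p. 135)] [cite: MumfordFogartyKirwan1994, Ch. 6 §2 Definition 6.3 (p. 120)] -/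
theorem map_fibreHom_eq_of_valueAt_eq [IsMonHom L] [IsMonHom L'] (Q : (A.fibre s).toAbelianVariety.Points Ω)
    (h : A.valueAt s D L Q = A.valueAt s D L' Q) :
    AlgPoints.map (fibreHom L s).hom.hom.hom Q = AlgPoints.map (fibreHom L' s).hom.hom.hom Q := by
  apply Over.OverMorphism.ext
  apply pullback.hom_ext
  · have h1 := left_comp_pullback_map_comp_fst (A := A) s L Q
    have h2 := left_comp_pullback_map_comp_fst (A := A) s L' Q
    rw [fibreHom_hom_hom_hom, fibreHom_hom_hom_hom, AlgPoints.map_apply, AlgPoints.map_apply]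
    exact h1.trans ((show A.fibrePointToLeft s Q ≫ L.left = A.fibrePointToLeft s Q ≫ L'.left from h).trans h2.symm)
  · exact (Over.w (Q ≫ (Over.pullback s).map L)).trans (Over.w (Q ≫ (Over.pullback s).map L')).symm

/-- §1 assembled: `L_s(Q) = L′_s(Q)` from `D^Θ_Q ∼ D^{Θ′}_Q`. [cite: MumfordFogartyKirwan1994, Ch. 6 §2 Definition 6.2–6.3 (p. 120)] [cite: MilneAV2008, I §8 pp. 36–37] -/
theorem map_fibreHom_eq_of_weilDiv_linEquiv [IsMonHom L] [IsMonHom L'] {Θ Θ' : CartierDivisor (A.fibre s).toAbelianVariety.X.left}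
    (hΘ : A.IsLambdaOfAt s D L Θ) (hΘ' : A.IsLambdaOfAt s D L' Θ') (Q : (A.fibre s).toAbelianVariety.Points Ω)
    (h : ((A.fibre s).toAbelianVariety.weilDiv Θ Q).LinEquiv ((A.fibre s).toAbelianVariety.weilDiv Θ' Q)) :
    AlgPoints.map (fibreHom L s).hom.hom.hom Q = AlgPoints.map (fibreHom L' s).hom.hom.hom Q :=
  map_fibreHom_eq_of_valueAt_eq D L L' s Q (valueAt_eq_valueAt_of_weilDiv_linEquiv D L L' s hΘ hΘ' Q h)

/-! ### §2 Rigidity on torsion: `L_s = L′_s`, and `L = L′` over `Spec Ω` -/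

/-- **RIGIDITY OF `Λ(𝒪(·))` ON TORSION POINTS**: over an algebraically closed field of characteristic `0`, two homomorphisms `L = Λ(𝒪(Θ))`, `L′ = Λ(𝒪(Θ′))` at `s` with
`D^Θ_Q ∼ D^{Θ′}_Q` for every TORSION point `Q` of `A_s(Ω)` have EQUAL fibres `L_s = L′_s : A_s → Â_s` (§1 at every torsion point + torsion points separate homomorphisms,
★ `hom_eq_of_forall_torsionPoints_map`). [cite: MumfordAV1970, §19 Thm. 3 (p. 176) and §20 (p. 186)] [cite: Milne1986AbelianVarieties, §12 Lemma 12.6] -/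
theorem fibreHom_eq_of_isLambdaOfAt_of_forall_torsion_weilDiv_linEquiv [IsAlgClosed Ω] [CharZero Ω] [IsMonHom L] [IsMonHom L']
    {Θ Θ' : CartierDivisor (A.fibre s).toAbelianVariety.X.left} (hΘ : A.IsLambdaOfAt s D L Θ) (hΘ' : A.IsLambdaOfAt s D L' Θ')
    (h : ∀ n : ℕ, 0 < n → ∀ Q ∈ (A.fibre s).toAbelianVariety.torsionPoints Ω n,
      ((A.fibre s).toAbelianVariety.weilDiv Θ Q).LinEquiv ((A.fibre s).toAbelianVariety.weilDiv Θ' Q)) :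
    fibreHom L s = fibreHom L' s :=
  AbelianVariety.hom_eq_of_forall_torsionPoints_map _ _ fun n hn Q hQ =>
    map_fibreHom_eq_of_weilDiv_linEquiv D L L' s hΘ hΘ' Q (h n hn Q hQ)

/-- **… and over `S = Spec Ω` itself the homomorphisms are EQUAL**: `L = L′` (the identity fibre `A ×_{Spec Ω} Spec Ω` is `A`: ★ `overPullbackIdIso`, so `Over.pullback (𝟙 _)` is
faithful). [cite: MumfordAV1970, §19 Thm. 3 (p. 176)] [cite: GortzWedhorn2020, Section (4.7) (p. 135)] -/
theorem eq_of_isLambdaOfAt_of_forall_torsion_weilDiv_linEquiv [IsAlgClosed Ω] [CharZero Ω] {A : AbelianSchemeOver (Spec (.of Ω))}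
    (D : A.DualPair) (L L' : A.X ⟶ D.hat.X) [IsMonHom L] [IsMonHom L']
    {Θ Θ' : CartierDivisor (A.fibre (𝟙 _)).toAbelianVariety.X.left} (hΘ : A.IsLambdaOfAt (𝟙 _) D L Θ) (hΘ' : A.IsLambdaOfAt (𝟙 _) D L' Θ')
    (h : ∀ n : ℕ, 0 < n → ∀ Q ∈ (A.fibre (𝟙 _)).toAbelianVariety.torsionPoints Ω n,
      ((A.fibre (𝟙 _)).toAbelianVariety.weilDiv Θ Q).LinEquiv ((A.fibre (𝟙 _)).toAbelianVariety.weilDiv Θ' Q)) :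
    L = L' := by
  have hf := fibreHom_eq_of_isLambdaOfAt_of_forall_torsion_weilDiv_linEquiv D L L' (𝟙 _) hΘ hΘ' h
  have hmap : (Over.pullback (𝟙 (Spec (.of Ω)))).map L = (Over.pullback (𝟙 (Spec (.of Ω)))).map L' := by
    rw [← fibreHom_hom_hom_hom, ← fibreHom_hom_hom_hom, hf]
  haveI : (Over.pullback (𝟙 (Spec (CommRingCat.of Ω)))).Faithful := Functor.Faithful.of_iso (overPullbackIdIso (Spec (.of Ω))).symm
  exact (Over.pullback (𝟙 (Spec (.of Ω)))).map_injective hmap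

end AbelianSchemeOver

end Literature.AlgebraicGeometry.AbelianSchemes

end
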